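import Literature.MathematicalPhysics.QuantumFieldTheory.ConformalBootstrap3D.BlockScaledExtraction
import Literature.MathematicalPhysics.QuantumFieldTheory.ConformalBootstrap3D.BlockExchangeSeries
import Literature.MathematicalPhysics.QuantumFieldTheory.ConformalBootstrap3D.BlockExchangeTransform
import HarnessLib

/-!
# Dolan–Osborn 2011 eq. (2.23): the `1 ↔ 2` exchange identity of the typed 3D blocks

Dolan–Osborn 2011 §2, eq. (2.23) (the first of the two symmetry relations that "follow directly" from
the four-point prefactor (2.22)):

  `F_{λ₁λ₂}(a,b;x',x̄') = (-1)^ℓ v^b F_{λ₁λ₂}(-a,b;x,x̄)`,  `x' = x/(x-1)`, `v = (1-x)(1-x̄)`,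

with `a = -Δ₁₂/2`, `b = Δ₃₄/2`. In the tree's language (`hrBlockAB Δ₁₂ Δ₃₄ Δ ℓ` = the Dolan–Osborn
`z`-series block `(z z̄)^{(Δ-ℓ)/2} Σ k^{ab}_{mn} z^m z̄^n`, `exchTransform b g (y,ȳ) = v^{-b} g(y', ȳ')`):
strictly above the unitarity bound and off the accidental-degeneracy set,

  `v^{-Δ₃₄/2} · hrBlockAB (-Δ₁₂) Δ₃₄ Δ ℓ (y/(y-1), ȳ/(ȳ-1)) = (-1)^ℓ · hrBlockAB Δ₁₂ Δ₃₄ Δ ℓ (y,ȳ)`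

for `(y,ȳ) ∈ (0,½)²` (`hrBlockAB_exch`) — the sub-square on which the `z`-series of the left-hand side is
known to converge (`|y/(y-1)| < 1`); it is an identity between the block and the analytic continuation of
the conjugate-dimension block to `(-1,0)²` given by its `z`-series.

Proof (this file only assembles): the left-hand side `S` solves the `(Δ₁₂,Δ₃₄)` Casimir equation on
`(0,½)²` (`casimirEq3D_exchTransform_hrBlockAB`: covariance of the Casimir operator under `x ↦ x/(x-1)`,
`BlockExchangeSymmetry`, and the equation of the `z`-series on the negative square,
`BlockReflectedCasimir`); `S = (yȳ)^α Σ e_{mn} y^m ȳ^n` with an explicit array `e = exchCoeff γ k^{(-a)b}`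
convergent for `|y|,|ȳ| < ½`, symmetric, with the Dolan–Osborn boundary row up to the sign `(-1)^ℓ`
(`BlockExchangeSeries`); extraction on the sub-square (`BlockScaledExtraction`) makes `e` a solution of
the monomial Casimir system; uniqueness of its normalised symmetric solution
(`SatisfiesCoeffCasimir.unique`, Hogervorst–Rychkov 2013 §3) gives `(-1)^ℓ e = k^{ab}`
(`neg_one_pow_mul_exchCoeff_eq`), and resummation gives the identity of functions.

Also: the consequence for any function satisfying the typed predicate `IsConformalBlock3DAbove`
(`IsConformalBlock3DAbove.eq_exch`) and the `σ–ε` odd-pair instance of pub-ising3d (`hrBlockAB_sigmaEps_exch`).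
The second relation of (2.23) (`symF b`: `F(a,b;x',x̄') = (-1)^ℓ v^a F(a,-b;x,x̄)`) follows from the first
and the `a ↔ b` symmetry of the Dolan–Osborn solution (`hrCoeffAB_comm`, `hrBlockAB_swap`):
`hrBlockAB_eq_exch_explicit'`, `hrBlockAB_exch'`.
Not here: the identity on the rest of the square `(0,1)² \ (0,½)²` (there the `z`-series of the left-hand
side diverges; it needs the `ρ`-expansion, Hogervorst–Rychkov 2013 §3.1).

Sources: F. A. Dolan, H. Osborn, arXiv:1108.6194, §2 eqs. (2.22)–(2.23); M. Hogervorst, S. Rychkov,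
arXiv:1303.1111, §3 eq. (3.9) (uniqueness of the normalised solution of the recursion).
-/

namespace Literature.MathematicalPhysics.QuantumFieldTheory.ConformalBootstrap3D

open Set Filter Topology

/-! ### Linearity of the coefficient system -/

/-- `E_{PQ}(c·k) = c·E_{PQ}(k)`. [folklore] -/
private theorem coeffCasimirLHS_const_mul (a b Δ : ℝ) (ℓ : ℕ) (c : ℝ) (k : ℕ × ℕ → ℝ) (P Q : ℕ) :
    coeffCasimirLHS a b Δ ℓ (fun q : ℕ × ℕ => c * k q) P Q = c * coeffCasimirLHS a b Δ ℓ k P Q := by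
  unfold coeffCasimirLHS
  split_ifs <;> ring

/-- Scalar multiples of solutions of the monomial Casimir system are solutions. [folklore] -/
private theorem SatisfiesCoeffCasimir.const_mul {a b Δ : ℝ} {ℓ : ℕ} {k : ℕ × ℕ → ℝ}
    (hk : SatisfiesCoeffCasimir a b Δ ℓ k) (c : ℝ) :
    SatisfiesCoeffCasimir a b Δ ℓ (fun q : ℕ × ℕ => c * k q) := by
  intro P Q
  rw [coeffCasimirLHS_const_mul, hk P Q, mul_zero]

section Exchange

variable {Δ₁₂ Δ₃₄ Δ : ℝ} {ℓ : ℕ}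

/-- The coefficient array of the exchange-transformed conjugate block
`v^{-b} g^{-Δ₁₂,Δ₃₄}∘(x ↦ x/(x-1)) = (yȳ)^α Σ e_{mn} y^m ȳ^n` solves the `(Δ₁₂,Δ₃₄)` monomial Casimir
system (Casimir equation on `(0,½)²` + extraction on the sub-square). [cite: DolanOsborn2011, §2 eq. (2.23)] -/
theorem satisfiesCoeffCasimir_exchCoeff (hΔ : unitarityBound3D ℓ < Δ) :
    SatisfiesCoeffCasimir (-Δ₁₂ / 2) (Δ₃₄ / 2) Δ ℓ
      (exchCoeff ((Δ - (ℓ : ℝ)) / 2 + Δ₃₄ / 2) (hrMonomialCoeffAB (Δ₁₂ / 2) (Δ₃₄ / 2) Δ ℓ)) := by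
  have hS₂ : IsDoublePowerSeriesOn (hrMonomialCoeffAB (Δ₁₂ / 2) (Δ₃₄ / 2) Δ ℓ)
      (hrSeriesAB (Δ₁₂ / 2) (Δ₃₄ / 2) Δ ℓ) := isDoublePowerSeriesOn_hrSeriesAB hΔ
  have hS : IsDoublePowerSeriesOn
      (fun q : ℕ × ℕ => (1 / 2 : ℝ) ^ (q.1 + q.2) *
        exchCoeff ((Δ - (ℓ : ℝ)) / 2 + Δ₃₄ / 2) (hrMonomialCoeffAB (Δ₁₂ / 2) (Δ₃₄ / 2) Δ ℓ) q)
      (exchSeriesHalf ((Δ - (ℓ : ℝ)) / 2 + Δ₃₄ / 2) (hrSeriesAB (Δ₁₂ / 2) (Δ₃₄ / 2) Δ ℓ)) :=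
    isDoublePowerSeriesOn_exchHalf hS₂ _
  refine satisfiesCoeffCasimir_of_casimirEq3D_subsquare
    (g := exchTransform (Δ₃₄ / 2) (hrBlockAB (-Δ₁₂) Δ₃₄ Δ ℓ)) (by norm_num : (0 : ℝ) < 1 / 2) hS
    ?_ ?_
  · intro τ τb hτ hτb
    have hy0 : 0 < 1 / 2 * τ := by linarith [hτ.1]
    have hy1 : 1 / 2 * τ < 1 / 2 := by linarith [hτ.2]
    have hyb0 : 0 < 1 / 2 * τb := by linarith [hτb.1]
    have hyb1 : 1 / 2 * τb < 1 / 2 := by linarith [hτb.2]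
    rw [exchTransform_hrBlockAB_eq Δ₁₂ Δ₃₄ Δ ℓ hy0 hy1 hyb0 hyb1, exchSeriesHalf,
      show τ / 2 = 1 / 2 * τ by ring, show τb / 2 = 1 / 2 * τb by ring]
  · intro τ τb hτ hτb
    exact casimirEq3D_exchTransform_hrBlockAB hΔ (by linarith [hτ.1]) (by linarith [hτ.2])
      (by linarith [hτb.1]) (by linarith [hτb.2])

/-- **Dolan–Osborn (2.23) on coefficient arrays**: `(-1)^ℓ e = k^{ab}` — the sign-corrected array of the
exchange-transformed conjugate block is the Dolan–Osborn array of `(a,b) = (-Δ₁₂/2, Δ₃₄/2)` (both are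
symmetric normalised solutions of the monomial system; uniqueness above the bound off the degeneracy set).
[cite: DolanOsborn2011, §2 eq. (2.23)] -/
theorem neg_one_pow_mul_exchCoeff_eq (hΔ : unitarityBound3D ℓ < Δ) (hreg : ¬ accidentalDegeneracy3D Δ ℓ) :
    (fun q : ℕ × ℕ => (-1 : ℝ) ^ ℓ *
        exchCoeff ((Δ - (ℓ : ℝ)) / 2 + Δ₃₄ / 2) (hrMonomialCoeffAB (Δ₁₂ / 2) (Δ₃₄ / 2) Δ ℓ) q) =
      hrMonomialCoeffAB (-Δ₁₂ / 2) (Δ₃₄ / 2) Δ ℓ := by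
  refine SatisfiesCoeffCasimir.unique hΔ hreg ((satisfiesCoeffCasimir_exchCoeff hΔ).const_mul _)
    (hrMonomialCoeffAB_satisfies _ _ hΔ) (fun p => ?_) (hrMonomialCoeffAB_symm _ _ Δ ℓ)
    (hasLeadingPart_exchCoeff _ (hrMonomialCoeffAB_hasLeadingPart _ _ Δ ℓ))
    (hrMonomialCoeffAB_hasLeadingPart _ _ Δ ℓ)
  show (-1 : ℝ) ^ ℓ * exchCoeff _ _ (p.2, p.1) = (-1 : ℝ) ^ ℓ * exchCoeff _ _ p
  rw [exchCoeff_symm _ (hrMonomialCoeffAB_symm (Δ₁₂ / 2) (Δ₃₄ / 2) Δ ℓ) p]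

/-- **Dolan–Osborn 2011 eq. (2.23), `1 ↔ 2` exchange symmetry of the 3D blocks**, on the sub-square
`(0,½)²`, strictly above the unitarity bound and off the accidental-degeneracy set, in the printed
direction: `g^{Δ₁₂,Δ₃₄}_{Δ,ℓ}(y,ȳ) = (-1)^ℓ v^{-Δ₃₄/2} g^{-Δ₁₂,Δ₃₄}_{Δ,ℓ}(y/(y-1), ȳ/(ȳ-1))`, where
`g^{Δ₁₂,Δ₃₄}_{Δ,ℓ} = hrBlockAB Δ₁₂ Δ₃₄ Δ ℓ` is the Dolan–Osborn `z`-series block (on `(-1,0)²` its series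
is the analytic continuation). [cite: DolanOsborn2011, §2 eq. (2.23)] -/
theorem hrBlockAB_eq_neg_one_pow_mul_exchTransform (hΔ : unitarityBound3D ℓ < Δ)
    (hreg : ¬ accidentalDegeneracy3D Δ ℓ) {y yb : ℝ} (hy0 : 0 < y) (hy1 : y < 1 / 2)
    (hyb0 : 0 < yb) (hyb1 : yb < 1 / 2) :
    hrBlockAB Δ₁₂ Δ₃₄ Δ ℓ y yb =
      (-1 : ℝ) ^ ℓ * exchTransform (Δ₃₄ / 2) (hrBlockAB (-Δ₁₂) Δ₃₄ Δ ℓ) y yb := by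
  have hS₂ : IsDoublePowerSeriesOn (hrMonomialCoeffAB (Δ₁₂ / 2) (Δ₃₄ / 2) Δ ℓ)
      (hrSeriesAB (Δ₁₂ / 2) (Δ₃₄ / 2) Δ ℓ) := isDoublePowerSeriesOn_hrSeriesAB hΔ
  have hya : |y| < 1 / 2 := by rwa [abs_of_pos hy0]
  have hyba : |yb| < 1 / 2 := by rwa [abs_of_pos hyb0]
  obtain ⟨hsum, -⟩ := hasSum_exchCoeff hS₂ ((Δ - (ℓ : ℝ)) / 2 + Δ₃₄ / 2) hya hyba
  have hk := neg_one_pow_mul_exchCoeff_eq (Δ₁₂ := Δ₁₂) (Δ₃₄ := Δ₃₄) hΔ hreg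
  have h1 : hrSeriesAB (-Δ₁₂ / 2) (Δ₃₄ / 2) Δ ℓ y yb = (-1 : ℝ) ^ ℓ *
      exchSeries ((Δ - (ℓ : ℝ)) / 2 + Δ₃₄ / 2) (hrSeriesAB (Δ₁₂ / 2) (Δ₃₄ / 2) Δ ℓ) y yb := by
    rw [hrSeriesAB, ← hk, ← hsum.tsum_eq, ← tsum_mul_left]
    exact tsum_congr fun p => by ring
  rw [exchTransform_hrBlockAB_eq Δ₁₂ Δ₃₄ Δ ℓ hy0 hy1 hyb0 hyb1, hrBlockAB, h1]
  ring

/-- (2.23) solved for the exchange transform: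
`v^{-Δ₃₄/2} g^{-Δ₁₂,Δ₃₄}_{Δ,ℓ}(y/(y-1), ȳ/(ȳ-1)) = (-1)^ℓ g^{Δ₁₂,Δ₃₄}_{Δ,ℓ}(y,ȳ)` on `(0,½)²`.
[cite: DolanOsborn2011, §2 eq. (2.23)] -/
theorem hrBlockAB_exch (hΔ : unitarityBound3D ℓ < Δ) (hreg : ¬ accidentalDegeneracy3D Δ ℓ)
    {y yb : ℝ} (hy0 : 0 < y) (hy1 : y < 1 / 2) (hyb0 : 0 < yb) (hyb1 : yb < 1 / 2) :
    exchTransform (Δ₃₄ / 2) (hrBlockAB (-Δ₁₂) Δ₃₄ Δ ℓ) y yb =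
      (-1 : ℝ) ^ ℓ * hrBlockAB Δ₁₂ Δ₃₄ Δ ℓ y yb := by
  have hsq : (-1 : ℝ) ^ ℓ * (-1 : ℝ) ^ ℓ = 1 := by
    rw [← pow_add, ← two_mul, pow_mul]; norm_num
  rw [hrBlockAB_eq_neg_one_pow_mul_exchTransform hΔ hreg hy0 hy1 hyb0 hyb1, ← mul_assoc, hsq, one_mul]

/-- (2.23) written out: `g^{Δ₁₂,Δ₃₄}(y,ȳ) = (-1)^ℓ ((1-y)(1-ȳ))^{-Δ₃₄/2} g^{-Δ₁₂,Δ₃₄}(y/(y-1), ȳ/(ȳ-1))`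
on `(0,½)²`. [cite: DolanOsborn2011, §2 eq. (2.23)] -/
theorem hrBlockAB_eq_exch_explicit (hΔ : unitarityBound3D ℓ < Δ)
    (hreg : ¬ accidentalDegeneracy3D Δ ℓ) {y yb : ℝ} (hy0 : 0 < y) (hy1 : y < 1 / 2)
    (hyb0 : 0 < yb) (hyb1 : yb < 1 / 2) :
    hrBlockAB Δ₁₂ Δ₃₄ Δ ℓ y yb =
      (-1 : ℝ) ^ ℓ * ((1 - y) ^ (-(Δ₃₄ / 2)) * (1 - yb) ^ (-(Δ₃₄ / 2)) *
        hrBlockAB (-Δ₁₂) Δ₃₄ Δ ℓ (y / (y - 1)) (yb / (yb - 1))) := by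
  rw [hrBlockAB_eq_neg_one_pow_mul_exchTransform hΔ hreg hy0 hy1 hyb0 hyb1, exchTransform,
    moebiusExch_def, moebiusExch_def]

/-- **(2.23) for the typed predicate.** Any function satisfying `IsConformalBlock3DAbove Δ₁₂ Δ₃₄ Δ ℓ`
(regular point above the bound) equals on `(0,½)²` the sign-corrected exchange transform of the
Dolan–Osborn block of the conjugate dimensions. [cite: DolanOsborn2011, §2 eq. (2.23)] -/
theorem IsConformalBlock3DAbove.eq_exch {g : ℝ → ℝ → ℝ} (hΔ : unitarityBound3D ℓ < Δ)
    (hreg : ¬ accidentalDegeneracy3D Δ ℓ) (h : IsConformalBlock3DAbove Δ₁₂ Δ₃₄ Δ ℓ g) {y yb : ℝ}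
    (hy0 : 0 < y) (hy1 : y < 1 / 2) (hyb0 : 0 < yb) (hyb1 : yb < 1 / 2) :
    g y yb = (-1 : ℝ) ^ ℓ * exchTransform (Δ₃₄ / 2) (hrBlockAB (-Δ₁₂) Δ₃₄ Δ ℓ) y yb := by
  rw [h.eq_hrBlockAB hΔ hreg y yb ⟨hy0, by linarith⟩ ⟨hyb0, by linarith⟩]
  exact hrBlockAB_eq_neg_one_pow_mul_exchTransform hΔ hreg hy0 hy1 hyb0 hyb1

/-- The `σ–ε` odd pair of pub-ising3d (`s = Δ_σ - Δ_ε`, block `g^{s,s}` of `⟨σεεσ⟩` versus `g^{-s,s}` of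
`⟨εσσε⟩`): `v^{-s/2} g^{-s,s}(y',ȳ') = (-1)^ℓ g^{s,s}(y,ȳ)` on `(0,½)²`. [cite: DolanOsborn2011, §2 eq. (2.23)] -/
theorem hrBlockAB_sigmaEps_exch (Δσ Δε : ℝ) (hΔ : unitarityBound3D ℓ < Δ)
    (hreg : ¬ accidentalDegeneracy3D Δ ℓ) {y yb : ℝ} (hy0 : 0 < y) (hy1 : y < 1 / 2)
    (hyb0 : 0 < yb) (hyb1 : yb < 1 / 2) :
    exchTransform ((Δσ - Δε) / 2) (hrBlockAB (-(Δσ - Δε)) (Δσ - Δε) Δ ℓ) y yb =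
      (-1 : ℝ) ^ ℓ * hrBlockAB (Δσ - Δε) (Δσ - Δε) Δ ℓ y yb :=
  hrBlockAB_exch hΔ hreg hy0 hy1 hyb0 hyb1

end Exchange

/-! ### The `a ↔ b` symmetry of the Dolan–Osborn solution and the second relation of (2.23) -/

section Swap

/-- The recursion weights `γ^±(a,b)` are symmetric in `(a,b)`, hence so are the `z`-series coefficients
`A_{n,j}(a,b)`. [cite: DolanOsborn2004, §3 eqs. (3.9), (3.11)] -/
theorem hrCoeffAB_comm (a b Δ : ℝ) (ℓ : ℕ) : ∀ n j : ℕ, hrCoeffAB a b Δ ℓ n j = hrCoeffAB b a Δ ℓ n j := by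
  intro n
  induction n with
  | zero => intro j; simp [hrCoeffAB]
  | succ n ih =>
    intro j
    rw [hrCoeffAB_succ, hrCoeffAB_succ, hrGammaPlusAB_comm, hrGammaMinusAB_comm, ih, ih]

/-- The monomial array `k^{ab}` is symmetric in `(a,b)`. [cite: DolanOsborn2004, §3 eqs. (3.9)–(3.11)] -/
theorem hrMonomialCoeffAB_comm (a b Δ : ℝ) (ℓ : ℕ) :
    hrMonomialCoeffAB a b Δ ℓ = hrMonomialCoeffAB b a Δ ℓ := by
  funext p
  unfold hrMonomialCoeffAB hrSliceAB
  simp only [hrCoeffAB_comm a b]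

/-- The `z`-series `K^{ab}` is symmetric in `(a,b)`. [cite: DolanOsborn2004, §3 eqs. (3.10)–(3.11)] -/
theorem hrSeriesAB_comm (a b Δ : ℝ) (ℓ : ℕ) : hrSeriesAB a b Δ ℓ = hrSeriesAB b a Δ ℓ := by
  funext z zb
  unfold hrSeriesAB
  rw [hrMonomialCoeffAB_comm]

/-- `a ↔ b` on the block: `g^{Δ₁₂,Δ₃₄}_{Δ,ℓ} = g^{-Δ₃₄,-Δ₁₂}_{Δ,ℓ}` (`(a,b) = (-Δ₁₂/2, Δ₃₄/2) ↦ (b,a)`).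
[cite: DolanOsborn2004, §3 eqs. (3.10)–(3.11)] -/
theorem hrBlockAB_swap (Δ₁₂ Δ₃₄ Δ : ℝ) (ℓ : ℕ) :
    hrBlockAB Δ₁₂ Δ₃₄ Δ ℓ = hrBlockAB (-Δ₃₄) (-Δ₁₂) Δ ℓ := by
  funext z zb
  unfold hrBlockAB
  rw [neg_neg, hrSeriesAB_comm (-Δ₁₂ / 2) (Δ₃₄ / 2)]

variable {Δ₁₂ Δ₃₄ Δ : ℝ} {ℓ : ℕ}

/-- **Dolan–Osborn 2011 eq. (2.23), second relation** (`symF b`):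
`F_{λ₁λ₂}(a,b;x',x̄') = (-1)^ℓ v^a F_{λ₁λ₂}(a,-b;x,x̄)`, i.e. on `(0,½)²` at regular `(Δ,ℓ)` above the bound
`g^{Δ₁₂,Δ₃₄}(y,ȳ) = (-1)^ℓ ((1-y)(1-ȳ))^{Δ₁₂/2} g^{Δ₁₂,-Δ₃₄}(y/(y-1), ȳ/(ȳ-1))` (from the first relation and
the `a ↔ b` symmetry). [cite: DolanOsborn2011, §2 eq. (2.23)] -/
theorem hrBlockAB_eq_exch_explicit' (hΔ : unitarityBound3D ℓ < Δ)
    (hreg : ¬ accidentalDegeneracy3D Δ ℓ) {y yb : ℝ} (hy0 : 0 < y) (hy1 : y < 1 / 2)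
    (hyb0 : 0 < yb) (hyb1 : yb < 1 / 2) :
    hrBlockAB Δ₁₂ Δ₃₄ Δ ℓ y yb =
      (-1 : ℝ) ^ ℓ * ((1 - y) ^ (Δ₁₂ / 2) * (1 - yb) ^ (Δ₁₂ / 2) *
        hrBlockAB Δ₁₂ (-Δ₃₄) Δ ℓ (y / (y - 1)) (yb / (yb - 1))) := by
  rw [hrBlockAB_swap Δ₁₂ Δ₃₄, hrBlockAB_eq_exch_explicit (Δ₁₂ := -Δ₃₄) (Δ₃₄ := -Δ₁₂) hΔ hreg hy0 hy1 hyb0 hyb1,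
    hrBlockAB_swap Δ₁₂ (-Δ₃₄), neg_neg, neg_div, neg_neg]

/-- The second relation solved for the transform: `v^{Δ₁₂/2} g^{Δ₁₂,-Δ₃₄}∘exch = (-1)^ℓ g^{Δ₁₂,Δ₃₄}` on `(0,½)²`
(`exchTransform (-Δ₁₂/2)`). [cite: DolanOsborn2011, §2 eq. (2.23)] -/
theorem hrBlockAB_exch' (hΔ : unitarityBound3D ℓ < Δ) (hreg : ¬ accidentalDegeneracy3D Δ ℓ)
    {y yb : ℝ} (hy0 : 0 < y) (hy1 : y < 1 / 2) (hyb0 : 0 < yb) (hyb1 : yb < 1 / 2) :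
    exchTransform (-(Δ₁₂ / 2)) (hrBlockAB Δ₁₂ (-Δ₃₄) Δ ℓ) y yb =
      (-1 : ℝ) ^ ℓ * hrBlockAB Δ₁₂ Δ₃₄ Δ ℓ y yb := by
  have hsq : (-1 : ℝ) ^ ℓ * (-1 : ℝ) ^ ℓ = 1 := by
    rw [← pow_add, ← two_mul, pow_mul]; norm_num
  rw [hrBlockAB_eq_exch_explicit' hΔ hreg hy0 hy1 hyb0 hyb1, exchTransform, moebiusExch_def,
    moebiusExch_def, neg_neg, ← mul_assoc ((-1 : ℝ) ^ ℓ) ((-1 : ℝ) ^ ℓ), hsq, one_mul]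

end Swap

end Literature.MathematicalPhysics.QuantumFieldTheory.ConformalBootstrap3D
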